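import Summits.Ventures.PackingBounds.Configurations.E8EnergyRigidity
import Summits.Ventures.PackingBounds.Energy.RieszAbsolutelyMonotone

/-!
# Uniqueness of the `E₈` ground state for absolutely monotone and Riesz potentials

Framing: lottery ticket; floor = certified bounds/negative ranges. Venture `PackingBounds` (cell
`pub-packcert`, seat `pub-packcert-energy`).

`E8EnergyRigidity.isometric_E8_of_energy_eq` proves uniqueness of the `240`-point ground state on `S⁷` for
power-series potentials `a = Σ c_k (1+t)^k` with some `c_k > 0`, `k ≥ 8`. By S. Bernstein's theorem
(`Literature.Analysis.Calculus.AbsolutelyMonotonePowerSeries.hasSum_taylor`) an absolutely monotonic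
potential on `[-1,1)` is such a series with `c_k = a^{(k)}(-1)/k!`; hence (`isometric_E8_of_energy_eq_of_absolutelyMonotoneOn`):
**if `a` is absolutely monotonic on `[-1,1)` with `a^{(8)}(-1) > 0` (one-sided, within `[-1,1)`), every
`240`-point configuration on `S⁷` with the minimal `a`-energy `240 (a(-1) + 56 a(-1/2) + 126 a(0) + 56 a(1/2))`
is isometric to the `E₈` root configuration.** For the inverse power laws `a(t) = (2 - 2t)^{-p}`
(`= |x - y|^{-2p}`), `p > 0`, the eighth derivative at `-1` is `2⁸ p(p+1)⋯(p+7) 4^{-p-8} > 0`, so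
(`riesz_ground_state_unique`): **for every `s > 0` the `E₈` roots are, up to isometry, the unique
minimiser of the Riesz `s`-energy among `240`-point configurations on `S⁷`** (Cohn–Kumar 2007, Thm. 1.2
with its uniqueness clause; the Coulomb/Thomson-type problem for `240` points in `ℝ⁸`).

## References
* H. Cohn, A. Kumar, *Universally optimal distribution of points on spheres*, J. Amer. Math. Soc. 20 (2007)
  99–148, Theorem 1.2. [`CohnKumar2006`]
* D. V. Widder, *The Laplace Transform* (1941), Ch. IV Thm. 3a (Bernstein). [`Widder1941`]
-/

noncomputable section

namespace Summit.Ventures.PackingBounds.Config.E8GroundState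

open Finset Set Literature.Analysis.Calculus
open scoped ContDiff

section config

variable {C : Finset (EuclideanSpace ℝ (Fin 8))} (h1 : ∀ x ∈ C, ‖x‖ = 1) (hN : C.card = 240)
include h1 hN

/-- **Unique ground state for absolutely monotonic potentials.** If `a` is absolutely monotonic on `[-1,1)`
with `a^{(8)}(-1) > 0` (iterated derivative within `[-1,1)`), a `240`-point configuration on `S⁷` whose
`a`-energy equals the universal lower bound `240 (a(-1) + 56 a(-1/2) + 126 a(0) + 56 a(1/2))` is isometric
to the `E₈` root configuration. [cite: CohnKumar2006, Theorem 1.2] -/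
theorem isometric_E8_of_energy_eq_of_absolutelyMonotoneOn (a : ℝ → ℝ)
    (ha : AbsolutelyMonotoneOn a (Ico (-1) 1))
    (h8 : 0 < iteratedDerivWithin 8 a (Ico (-1) 1) (-1))
    (hE : ∑ x ∈ C, ∑ y ∈ C.erase x, a (inner ℝ x y) =
      (240 : ℝ) * (a (-1) + 56 * a (-1 / 2) + 126 * a 0 + 56 * a (1 / 2))) :
    ∃ Ψ : EuclideanSpace ℝ (Fin 8) ≃ₗᵢ[ℝ] EuclideanSpace ℝ (Fin 8), C = E8.pts.image Ψ := by
  set c : ℕ → ℝ := fun k => iteratedDerivWithin k a (Ico (-1) 1) (-1) / (Nat.factorial k) with hc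
  have hc0 : ∀ k, 0 ≤ c k := fun k =>
    div_nonneg (ha.iteratedDerivWithin_nonneg (uniqueDiffOn_Ico (-1) 1) k ⟨le_rfl, by norm_num⟩)
      (Nat.cast_nonneg _)
  have hsum : ∀ s : ℝ, -1 ≤ s → s < 1 → HasSum (fun k => c k * (1 + s) ^ k) (a s) := by
    intro s hs1 hs2
    have h := AbsolutelyMonotonePowerSeries.hasSum_taylor ha (x := s) ⟨hs1, hs2⟩
    simpa only [hc, sub_neg_eq_add, add_comm s 1] using h
  have hc8 : 0 < c 8 := div_pos h8 (by positivity)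
  exact E8EnergyRigidity.isometric_E8_of_energy_eq h1 hN a c hc0 hsum 8 le_rfl hc8 hE

end config

/-- Closed form of the iterated derivatives of `t ↦ (2 - 2t)^{-p}` on `t < 1`:
`a^{(k)}(x) = (2^k ∏_{i<k} (p+i)) (2 - 2x)^{-p-k}`. [folklore] -/
private theorem iteratedDeriv_rpow_chordal (p : ℝ) (k : ℕ) :
    ∀ x : ℝ, x < 1 → iteratedDeriv k (fun t : ℝ => (2 - 2 * t) ^ (-p)) x =
      (2 ^ k * ∏ i ∈ range k, (p + i)) * (2 - 2 * x) ^ (-p - k) := by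
  induction k with
  | zero => intro x _; simp
  | succ k ih =>
    intro x hx
    rw [iteratedDeriv_succ]
    have hev : iteratedDeriv k (fun t : ℝ => (2 - 2 * t) ^ (-p)) =ᶠ[nhds x]
        fun y => (2 ^ k * ∏ i ∈ range k, (p + i)) * (2 - 2 * y) ^ (-p - k) := by
      have hopen : IsOpen (Iio (1 : ℝ)) := isOpen_Iio
      filter_upwards [hopen.mem_nhds hx] with y hy using ih y hy
    rw [hev.deriv_eq]
    have h2x : (2 : ℝ) - 2 * x ≠ 0 := by linarith
    have hlin : HasDerivAt (fun y : ℝ => 2 - 2 * y) (-2) x := by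
      simpa using ((hasDerivAt_id x).const_mul (2 : ℝ)).const_sub 2
    have hpow := hlin.rpow_const (p := -p - k) (Or.inl h2x)
    have hder := hpow.const_mul (2 ^ k * ∏ i ∈ range k, (p + i))
    rw [hder.deriv, Finset.prod_range_succ]
    have hsplit : (2 - 2 * x) ^ (-p - (k : ℝ) - 1) = (2 - 2 * x) ^ (-p - ((k + 1 : ℕ) : ℝ)) := by
      congr 1; push_cast; ring
    rw [hsplit]
    ring

/-- Every one-sided derivative of `(2 - 2t)^{-p}` at `-1` is positive for `p > 0`. -/
theorem iteratedDerivWithin_rpow_chordal_pos (p : ℝ) (hp : 0 < p) (k : ℕ) :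
    0 < iteratedDerivWithin k (fun t : ℝ => (2 - 2 * t) ^ (-p)) (Ico (-1) 1) (-1) := by
  have hS := uniqueDiffOn_Ico (-1 : ℝ) 1
  have hcd : ContDiffAt ℝ ∞ (fun t : ℝ => (2 - 2 * t) ^ (-p)) (-1) := by
    have h2x : (2 : ℝ) - 2 * (-1) ≠ 0 := by norm_num
    exact (Real.contDiffAt_rpow_const_of_ne (p := -p) h2x).comp (-1)
      ((contDiffAt_const.sub (contDiffAt_const.mul contDiffAt_id)))
  have hmem : (-1 : ℝ) ∈ Ico (-1 : ℝ) 1 := ⟨le_rfl, by norm_num⟩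
  rw [iteratedDerivWithin_eq_iteratedDeriv hS (hcd.of_le (mod_cast le_top)) hmem,
    iteratedDeriv_rpow_chordal p k (-1) (by norm_num)]
  have hprod : 0 < ∏ i ∈ range k, (p + i) := Finset.prod_pos fun i _ => by positivity
  have hpow : 0 < (2 - 2 * (-1 : ℝ)) ^ (-p - (k : ℕ)) := Real.rpow_pos_of_pos (by norm_num) _
  positivity

section riesz

variable {C : Finset (EuclideanSpace ℝ (Fin 8))} (h1 : ∀ x ∈ C, ‖x‖ = 1) (hN : C.card = 240)
include h1 hN

/-- **The `E₈` roots are the unique minimiser of every Riesz energy among `240` points on `S⁷`.** For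
`p > 0`, a `240`-point configuration of unit vectors of `ℝ⁸` whose energy `Σ_{x ≠ y} (2 - 2⟨x,y⟩)^{-p}`
(`= Σ |x - y|^{-2p}`) equals the minimum `240 (4^{-p} + 56 · 3^{-p} + 126 · 2^{-p} + 56)`
(`Energy.riesz_energy_ge_E8`) is isometric to the `E₈` root configuration `Config.E8.pts`.
[cite: CohnKumar2006, Theorem 1.2] -/
theorem riesz_ground_state_unique (p : ℝ) (hp : 0 < p)
    (hE : ∑ x ∈ C, ∑ y ∈ C.erase x, (2 - 2 * inner ℝ x y) ^ (-p) =
      (240 : ℝ) * ((4 : ℝ) ^ (-p) + 56 * (3 : ℝ) ^ (-p) + 126 * (2 : ℝ) ^ (-p) + 56)) :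
    ∃ Ψ : EuclideanSpace ℝ (Fin 8) ≃ₗᵢ[ℝ] EuclideanSpace ℝ (Fin 8), C = E8.pts.image Ψ := by
  refine isometric_E8_of_energy_eq_of_absolutelyMonotoneOn h1 hN (fun t : ℝ => (2 - 2 * t) ^ (-p))
    (Energy.RieszAbsolutelyMonotone.absolutelyMonotoneOn_rpow_chordal p hp.le)
    (iteratedDerivWithin_rpow_chordal_pos p hp 8) ?_
  rw [hE]
  norm_num

end riesz

section strict

variable {C : Finset (EuclideanSpace ℝ (Fin 8))} (h1 : ∀ x ∈ C, ‖x‖ = 1) (hN : C.card = 240)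
include h1 hN

/-- **Unique ground state, Cohn–Kumar's hypothesis.** If `a` is absolutely monotonic on `[-1,1)` and SOME
one-sided derivative `a^{(k)}(-1)` with `k ≥ 8` is positive — in particular if `a` is strictly absolutely
monotonic (not a polynomial of degree `< 8`) — then every `240`-point configuration on `S⁷` with the minimal
`a`-energy is isometric to the `E₈` root configuration. [cite: CohnKumar2006, Theorem 1.2] -/
theorem isometric_E8_of_energy_eq_of_absolutelyMonotoneOn' (a : ℝ → ℝ)
    (ha : AbsolutelyMonotoneOn a (Ico (-1) 1)) (k : ℕ) (hk : 8 ≤ k)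
    (hpos : 0 < iteratedDerivWithin k a (Ico (-1) 1) (-1))
    (hE : ∑ x ∈ C, ∑ y ∈ C.erase x, a (inner ℝ x y) =
      (240 : ℝ) * (a (-1) + 56 * a (-1 / 2) + 126 * a 0 + 56 * a (1 / 2))) :
    ∃ Ψ : EuclideanSpace ℝ (Fin 8) ≃ₗᵢ[ℝ] EuclideanSpace ℝ (Fin 8), C = E8.pts.image Ψ := by
  set c : ℕ → ℝ := fun j => iteratedDerivWithin j a (Ico (-1) 1) (-1) / (Nat.factorial j) with hc
  have hc0 : ∀ j, 0 ≤ c j := fun j =>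
    div_nonneg (ha.iteratedDerivWithin_nonneg (uniqueDiffOn_Ico (-1) 1) j ⟨le_rfl, by norm_num⟩)
      (Nat.cast_nonneg _)
  have hsum : ∀ s : ℝ, -1 ≤ s → s < 1 → HasSum (fun j => c j * (1 + s) ^ j) (a s) := by
    intro s hs1 hs2
    have h := AbsolutelyMonotonePowerSeries.hasSum_taylor ha (x := s) ⟨hs1, hs2⟩
    simpa only [hc, sub_neg_eq_add, add_comm s 1] using h
  have hck : 0 < c k := div_pos hpos (by positivity)
  exact E8EnergyRigidity.isometric_E8_of_energy_eq h1 hN a c hc0 hsum k hk hck hE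

end strict

end Summit.Ventures.PackingBounds.Config.E8GroundState

end
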